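import Summits.ABC.IUTFork.Conditional.WRowUnconditionalPackages
import Summits.ABC.IUTFork.Conditional.AbcOfSHwBadMReyssatArith
import Summits.ABC.IUTFork.Cor312GenuineKTwistLowerBoundUnconditional
import HarnessLib

/-!
# R-W WINDOW-TABLE, W3 «UNIFORM LEMMA» lane, INHABITED side — bad primes and admissible index SHAPES at ANY level `l` (row «W:INHABITED-BANDS», C-R72)

PROOF-ONLY support file (D-0012; 0 definitions, 0 `Prop` facts) of the abc-iut cell — D-0079 RESCUE sub-cell R-W «WINDOW Θ-SIDE INEQUALITY», seat
abc-iut-W-num-6 (gen 3). For the genuine Θ-volume data over the known abc triple of `InhUniformBandReyssat.lean` (its consumer): which primes carry bad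
fibre points at level `l` and with which pole order of `j` (`j` is regular away from `abc`; `p ≠ 2, l` — abc-iut-C-cert-3's
`ne_two_and_ne_l_of_placeOf_mem_S_pilotDataOfK`), and the divisibility class `e(K_x/ℚ_p) ∈ E₀(p)·l·ℕ` of the ramification index at a bad `x | p`
from the tree's LOWER bounds (abc-iut-W-neg-1 `GenuineK.prime_dvd_absRamificationIdx_kOf_ratPoint` / `fifteen_mul_prime_dvd_…` (Tate root),
abc-iut-W-neg-2 `GenuineK.sub_one_dvd_absRamificationIdx_kOf` (`μ_p ⊆ F`, `p ∣ 30`) / `thirty_mul_prime_dvd_…_mul_three`, abc-iut-w4-d107's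
unconditional twist factor `GenuineK.thirty_mul_prime_dvd_absRamificationIdx_kOf_mul_of_odd_pole` at an odd pole of `λ`). Pattern of abc-iut-w4-d094's
`WRow.bad_prime_frey343` / abc-iut-W-row-1's `WRow.dvd_absRamificationIdx_frey283` with the level a variable. HONEST SCOPE: classical local/global
number theory over OUR typed datum; nothing here bears on the printed inequality of [IUTchIII] Cor. 3.12; typed ≠ proved; no abc claim.
[cite: Mochizuki2012, IUTchI Def. 3.1 (b),(c) pp. 61–62, Ex. 3.2 (iv) p. 71; IUTchIV Thm. 1.10 p. 22, Cor. 2.2 (ii) proof (P5) p. 46]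
[cite: SilvermanATAEC1994, V.5 Thm. 5.3 and Cor. 5.4] [cite: SilvermanAEC2009, Prop. III.1.7(b), Prop. VII.5.1(b)] [cite: Washington1997, Prop. 2.1]
[claim: Mochizuki2012, status: disputed] for every IUT sentence.
-/

noncomputable section

open Set Function Metric NumberField IsDedekindDomain

namespace Summit.ABC.IUTFork.Conditional

open Thm311 Thm311.Real Cor312 Cor312Vol Cor312Prov Literature.IUT.LogThetaLattice Literature.IUT.LogVolume
  Literature.IUT.HodgeTheaters Literature.IUT.LogVolume.Cor22
open Literature.NumberTheory.NumberFields Literature.NumberTheory.GaloisRepresentations.Ultrametric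
open Literature.NumberTheory.DiophantineGeometry Literature.NumberTheory.DiophantineGeometry.GenEll

/-! ## §1. Arithmetic of `λ = 2/23⁵`; the bad primes and the admissible index shapes at ANY level `l` -/

/-- `ord_v(2/23⁵) = −5` at the place of `ℚ` over `23` (an ODD pole of `λ`). [folklore] -/
theorem InhBand.ord_lam_reyssat (v : HeightOneSpectrum (𝓞 ℚ)) (hv : Rat.HeightOneSpectrum.natGenerator v = 23) :
    ord ℚ v (((2 : ℕ) : ℚ) / (23 ^ 5 : ℕ)) = -((5 : ℕ) : ℤ) := by
  have hx : ((((2 : ℕ) : ℚ) / (23 ^ 5 : ℕ)) : ℚ) ≠ 0 := by positivity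
  rw [GenuineK.ord_rat_eq_padicValRat v hx, hv]
  haveI : Fact (Nat.Prime 23) := ⟨by norm_num⟩
  have h2 : ((2 : ℕ) : ℚ) ≠ 0 := by positivity
  have h23 : ((23 ^ 5 : ℕ) : ℚ) ≠ 0 := by positivity
  rw [padicValRat.div h2 h23, padicValRat.of_nat, padicValRat.of_nat, padicValNat.eq_zero_of_not_dvd (by norm_num),
    padicValNat.prime_pow]
  norm_num

/-- `j(2/23⁵) ≠ 1728` (`j = 2⁸(cb + a²)³/(abc)²` at the Reyssat triple, abc-iut-S6's `Cor22.jInv_ratPoint_triple`). [cite: SilvermanAEC2009, Prop. III.1.7(b)] -/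
theorem InhBand.jInv_ne_reyssat : jInv (((2 : ℕ) : ℚ) / (23 ^ 5 : ℕ)) ≠ 1728 := by
  rw [jInv_ratPoint_triple Literature.Barriers.ABC.reyssat_isABCTriple]
  norm_num

/-- **Which primes carry bad fibre points at `(ratPoint (2/23⁵), l)`, and the pole order there** (any level): a bad `x | p` has `p ≠ l` and lies over a
prime of `abc = 2·3¹⁰·109·23⁵` other than `2` (abc-iut-W-row-2's `Cor312Prov.natCast_dvd_of_placeOf_mem_S_triple`, abc-iut-C-cert-3's
`ne_two_and_ne_l_of_placeOf_mem_S_pilotDataOfK`), with `ord_p j = −2·v_p(abc) = −20, −10, −2` over `3, 23, 109` (this seat's `MShallowReyssat.ord_jInv_of_eq`,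
p482411). [cite: Mochizuki2012, IUTchI Def. 3.1 (b) p. 61; IUTchIV Cor. 2.2 (ii) proof (P5) p. 46] [cite: SilvermanAEC2009, Prop. III.1.7(b)]
[claim: Mochizuki2012, status: disputed] -/
theorem InhBand.bad_prime_reyssat {l : ℕ} (T : Cor22.ThetaVolumeDatumAt (ratPoint (((2 : ℕ) : ℚ) / (23 ^ 5 : ℕ))) l) (pp : Nat.Primes) :
    letI := T.instFieldF; letI := T.instNumberFieldF; letI := T.instAlgebraF; letI := T.instFieldK
    letI := T.instNumberFieldK; letI := T.instAlgebraK; letI := T.instFieldFbar; letI := T.instAlgebraFbar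
    letI := T.instAlgebraKFbar; letI := T.instIsElliptic
    haveI : Fact (pp : ℕ).Prime := ⟨pp.2⟩
    ∀ x : (thetaIndex (pilotDataOfK T.D T.K)).Fibre (.inr pp), placeOf (pilotDataOfK T.D T.K) pp.1 x ∈ (pilotDataOfK T.D T.K).S →
      (pp : ℕ) ≠ l ∧
      (((pp : ℕ) = 3 ∧ ord ℚ (finBelow ℚ T.K (placeOf (pilotDataOfK T.D T.K) pp.1 x)) (jInv (((2 : ℕ) : ℚ) / (23 ^ 5 : ℕ))) = -20) ∨
      ((pp : ℕ) = 23 ∧ ord ℚ (finBelow ℚ T.K (placeOf (pilotDataOfK T.D T.K) pp.1 x)) (jInv (((2 : ℕ) : ℚ) / (23 ^ 5 : ℕ))) = -10) ∨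
      ((pp : ℕ) = 109 ∧ ord ℚ (finBelow ℚ T.K (placeOf (pilotDataOfK T.D T.K) pp.1 x)) (jInv (((2 : ℕ) : ℚ) / (23 ^ 5 : ℕ))) = -2)) := by
  letI := T.instFieldF; letI := T.instNumberFieldF; letI := T.instAlgebraF; letI := T.instFieldK
  letI := T.instNumberFieldK; letI := T.instAlgebraK; letI := T.instFieldFbar; letI := T.instAlgebraFbar
  letI := T.instAlgebraKFbar; letI := T.instIsElliptic
  haveI : Fact (pp : ℕ).Prime := ⟨pp.2⟩
  intro x hx
  have hjF : T.E.j = ((jInv (((2 : ℕ) : ℚ) / (23 ^ 5 : ℕ)) : ℚ) : T.F) := by rw [T.j_eq]; exact eq_ratCast _ _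
  have hdvd := Cor312Prov.natCast_dvd_of_placeOf_mem_S_triple T.D Literature.Barriers.ABC.reyssat_isABCTriple hjF pp x hx
  obtain ⟨h2, hl'⟩ := ne_two_and_ne_l_of_placeOf_mem_S_pilotDataOfK T.D pp x hx
  have hgen := natGenerator_finBelow_placeOf T.D pp x
  have hord := MShallowReyssat.ord_jInv_of_eq (finBelow ℚ T.K (placeOf (pilotDataOfK T.D T.K) pp.1 x)) hgen h2 hdvd
  refine ⟨hl', ?_⟩
  rcases MShallowReyssat.eq_of_prime_dvd pp.2 hdvd with h | h | h | h
  · exact absurd h h2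
  · refine Or.inl ⟨h, ?_⟩
    rw [hord, h, MShallowReyssat.factorization_three]; norm_num
  · refine Or.inr (Or.inr ⟨h, ?_⟩)
    rw [hord, h, MShallowReyssat.factorization_hundrednine]; norm_num
  · refine Or.inr (Or.inl ⟨h, ?_⟩)
    rw [hord, h, MShallowReyssat.factorization_twentythree]; norm_num

/-- **The admissible index shapes at the bad fibre of the Reyssat datum, any level `l`**: `e(K_x/ℚ_p) = E₀(p)·l·m` with `m ≥ 1` and
`E₀(3) = 6` (`2 ∣ e`: `μ_3 ⊆ F`, abc-iut-W-neg-2 `GenuineK.sub_one_dvd_absRamificationIdx_kOf`; `3·l ∣ e`: Tate root + `l`-division layer at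
`ord_3 j = −20`, `GenuineK.thirty_mul_prime_dvd_absRamificationIdx_kOf_mul_three`; `l` odd), `E₀(23) = 6` (`λ = 2/23⁵` has an ODD pole at `23`:
abc-iut-w4-d107's UNCONDITIONAL twist factor `GenuineK.thirty_mul_prime_dvd_absRamificationIdx_kOf_mul_of_odd_pole`, `30·l ∣ 5e`), `E₀(109) = 15`
(abc-iut-W-neg-1 `GenuineK.fifteen_mul_prime_dvd_absRamificationIdx_kOf_ratPoint_of_coprime`, `t = 1`). [cite: SilvermanATAEC1994, V.5 Thm. 5.3 and Cor. 5.4]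
[cite: SilvermanAEC2009, Prop. VII.5.1(b)] [cite: Washington1997, Prop. 2.1] [cite: Mochizuki2012, IUTchI Ex. 3.2 (iv) p. 71; IUTchIV Thm. 1.10 p. 22]
[claim: Mochizuki2012, status: disputed] -/
theorem InhBand.shape_reyssat {l : ℕ} (T : Cor22.ThetaVolumeDatumAt (ratPoint (((2 : ℕ) : ℚ) / (23 ^ 5 : ℕ))) l) (pp : Nat.Primes) :
    letI := T.instFieldF; letI := T.instNumberFieldF; letI := T.instAlgebraF; letI := T.instFieldK
    letI := T.instNumberFieldK; letI := T.instAlgebraK; letI := T.instFieldFbar; letI := T.instAlgebraFbar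
    letI := T.instAlgebraKFbar; letI := T.instIsElliptic
    haveI : Fact (pp : ℕ).Prime := ⟨pp.2⟩
    ∀ x : (thetaIndex (pilotDataOfK T.D T.K)).Fibre (.inr pp), placeOf (pilotDataOfK T.D T.K) pp.1 x ∈ (pilotDataOfK T.D T.K).S →
      ∃ m : ℕ, 1 ≤ m ∧ absRamificationIdx (pp : ℕ) (kOf (pilotDataOfK T.D T.K) pp.1 x) =
        (if (pp : ℕ) = 3 then 6 else if (pp : ℕ) = 23 then 6 else 15) * l * m := by
  letI := T.instFieldF; letI := T.instNumberFieldF; letI := T.instAlgebraF; letI := T.instFieldK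
  letI := T.instNumberFieldK; letI := T.instAlgebraK; letI := T.instFieldFbar; letI := T.instAlgebraFbar
  letI := T.instAlgebraKFbar; letI := T.instIsElliptic
  haveI : Fact (pp : ℕ).Prime := ⟨pp.2⟩
  intro x hx
  have hl5 : 5 ≤ l := T.D.five_le_l
  have hlodd : Odd l := T.D.l_prime.odd_of_ne_two (by omega)
  have hpos := absRamificationIdx_pos (pp : ℕ) (kOf (pilotDataOfK T.D T.K) pp.1 x)
  obtain ⟨hpl, hcases⟩ := InhBand.bad_prime_reyssat T pp x hx
  have hgen := natGenerator_finBelow_placeOf T.D pp x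
  -- pole orders in the `∀ v` form the lower-bound lemmas want
  have hpole : ∀ {p₀ : ℕ} (t : ℕ), (p₀ = 3 ∧ t = 10) ∨ (p₀ = 23 ∧ t = 5) ∨ (p₀ = 109 ∧ t = 1) →
      ∀ v : HeightOneSpectrum (𝓞 ℚ), Rat.HeightOneSpectrum.natGenerator v = p₀ → ord ℚ v (jInv (((2 : ℕ) : ℚ) / (23 ^ 5 : ℕ))) = -(2 * (t : ℤ)) := by
    intro p₀ t ht v hv
    have hp2 : p₀ ≠ 2 := by rcases ht with h | h | h <;> omega
    have hd : p₀ ∣ 2 * (3 ^ 10 * 109) * 23 ^ 5 := by rcases ht with h | h | h <;> rw [h.1] <;> norm_num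
    rw [MShallowReyssat.ord_jInv_of_eq v hv hp2 hd]
    rcases ht with ⟨rfl, rfl⟩ | ⟨rfl, rfl⟩ | ⟨rfl, rfl⟩
    · rw [MShallowReyssat.factorization_three]
    · rw [MShallowReyssat.factorization_twentythree]
    · rw [MShallowReyssat.factorization_hundrednine]
  have hdvd : (if (pp : ℕ) = 3 then 6 else if (pp : ℕ) = 23 then 6 else 15) * l ∣ absRamificationIdx (pp : ℕ) (kOf (pilotDataOfK T.D T.K) pp.1 x) := by
    rcases hcases with ⟨hp, -⟩ | ⟨hp, -⟩ | ⟨hp, -⟩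
    · have hpp : pp = ⟨3, Nat.prime_three⟩ := Subtype.ext hp
      subst hpp
      show 6 * l ∣ _
      have h2 : (3 - 1) ∣ absRamificationIdx 3 (kOf (pilotDataOfK T.D T.K) 3 x) :=
        GenuineK.sub_one_dvd_absRamificationIdx_kOf T ⟨3, Nat.prime_three⟩ (by norm_num) x
      have h30 : 30 * l ∣ absRamificationIdx 3 (kOf (pilotDataOfK T.D T.K) 3 x) * 10 :=
        GenuineK.thirty_mul_prime_dvd_absRamificationIdx_kOf_mul_three T (fun h => hpl h.symm) (t := 10) (by norm_num)
          (hpole 10 (Or.inl ⟨rfl, rfl⟩)) x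
      have h3l : 3 * l ∣ absRamificationIdx 3 (kOf (pilotDataOfK T.D T.K) 3 x) :=
        Nat.dvd_of_mul_dvd_mul_right (by norm_num : 0 < 10) (by rwa [show 3 * l * 10 = 30 * l by ring])
      have hcop : Nat.Coprime 2 (3 * l) := Nat.coprime_two_left.mpr ((by decide : Odd 3).mul hlodd)
      have h := Nat.Coprime.mul_dvd_of_dvd_of_dvd hcop (by norm_num at h2; exact h2) h3l
      rwa [show 2 * (3 * l) = 6 * l by ring] at h
    · simp only [hp]; norm_num
      have h30 : 30 * l ∣ absRamificationIdx (pp : ℕ) (kOf (pilotDataOfK T.D T.K) pp.1 x) * 5 :=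
        GenuineK.thirty_mul_prime_dvd_absRamificationIdx_kOf_mul_of_odd_pole T InhBand.jInv_ne_reyssat pp (by rw [hp]; norm_num) hpl
          (t := 5) (by decide) (fun v hv => by rw [InhBand.ord_lam_reyssat v (by rw [hv, hp])]) x
      exact Nat.dvd_of_mul_dvd_mul_right (by norm_num : 0 < 5) (by rwa [show 6 * l * 5 = 30 * l by ring])
    · simp only [hp]; norm_num
      exact GenuineK.fifteen_mul_prime_dvd_absRamificationIdx_kOf_ratPoint_of_coprime T pp (by rw [hp]; norm_num) hpl (t := 1)
        (by norm_num) (by decide) (fun v hv => hpole 1 (Or.inr (Or.inr ⟨hp, rfl⟩)) v hv) x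
  obtain ⟨m, hm⟩ := hdvd
  refine ⟨m, ?_, hm⟩
  rcases Nat.eq_zero_or_pos m with h0 | h0
  · rw [h0, mul_zero] at hm; omega
  · exact h0

end Summit.ABC.IUTFork.Conditional

end
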